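import Summits.ABC.IUTFork.Repair.RHReqsideWeightLawsSignDatum
import HarnessLib

/-!
# D-0122 AXIS B, knob k1 — THE TYPED FORM, part 3c: THE T-WORD BOUNDS AS THEOREMS — datum-wise ratio transfer `a·T_f ≤ b·T_g` from termwise
# law inequalities: `κ = 1`: `T ≤ T_print/3`; affine `½`: `T ≤ T_print/2` (mass units); `κ = 3/2`: `T ≤ (2/3)·T_print`; shift `a`:
# `T ≥ (1 + 2a/(l⋆+1))·T_print`; affine `c ≥ 1`: `T ≥ c·T_print`; `κ = 5/2`: `T ≥ (5/3)·T_print`; `κ = 3`: `T ≥ (7/3)·T_print`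

abc-iut cell, rung LADDER-ABC:A2.RESCUE.H; seat abc-iut-reqb-typ-1 (GEN 3; D-0122 axis B typer k1/k4); owner abc-iut-rh-lead g3/g4 (`plan/rescue/R-H/ROUND3/REQB-SPEC.md`
v0.2 §6(a)(P4): T-words «NO CHANGE (|·−1| < 0.01) · REDUCES (≤ 0.9) · REDUCES-STRONGLY (≤ 0.5) · VANISHES · INCREASES (≥ 1.01) on `T_mod/T`, pooled and median»);
table of record `REQB-TABLE.tsv` v1 b8ac679ede5d795b (k1 singles, side w, beds FREY133 | HEX79, column `Tmod/T_pooled`: S-k1-kappa1 0.0002 | 0.0000,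
S-k1-affine1/2 0.0951 | 0.0413, S-k1-kappa3/2 0.0185 | 0.0096, S-k1-shift1 1.2250 | 1.1988, S-k1-shift2 1.4575 | 1.3939, S-k1-affine2 3.4554 | 3.0693,
S-k1-kappa5/2 16.9066 | 32.1817). Parts 3a/3b = `Repair/RHReqsideWeightLawsSign.lean` p516945 (`offDemand`, the sign theorem) / `…SignDatum.lean` p517864
(`datumOff`); parts 1/2 = p506542 / p508156. Nothing re-typed.

WHAT IS PROVED (namespace `Summit.ABC.IUTFork.Repair.RH.ReqsideWeightLaws`). Part 3a proved the SIGN of `T_mod − T_print` for every k1 row; here the sign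
theorem is sharpened to a RATIO by carrying a termwise constant through the same unlicensed-set inclusion:
* §1 `offDemand_ratio_le` — if on labels `1 ≤ j ≤ L`: `f/den ≤ g/den′` (antitonicity: every `g`-cell is an `f`-cell), `den′ ≤ g`, and
  `a·(f(j) − den) ≤ b·(g(j) − den′)` with `b ≥ 0`, then **`a·T_f(w) ≤ b·T_g(w)`** (label units; `e > 0`, `m ≥ 0`); pooled: `datumOff_ratio_le`
  (`a·den·T_f(datum) ≤ b·den′·T_g(datum)` in nats, weights `q_w ≥ 0`) — so a datum-wise ratio bound holds for every pooled sum and every order statistic.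
* §2 THE LAW INEQUALITIES (pure label arithmetic, all `j ≥ 1`): `3(j − 1) ≤ j² − 1` · `3(⌈j^{3/2}⌉ − 1) ≤ 2(j² − 1)` (certificate `⌈j^{3/2}⌉ ≤ ⌊(2j²+1)/3⌋`,
  no root evaluated) · `j² − 2 ≤ j² − 1` (affine ½ at `den = 2`) · `(L+1+2a)(j² − 1) ≤ (L+1)((j+a)² − (1+a)²)` for `j ≤ L` · `c(j² − 1) ≤ c·j² − 1` (`c ≥ 1`) ·
  `5(j² − 1) ≤ 3(⌈j^{5/2}⌉ − 1)` (certificate `⌈j^{5/2}⌉ ≥ 2j²` for `j ≥ 4`, `≥ 6, 16` at `j = 2, 3`) · `7(j² − 1) ≤ 3(j³ − 1)`.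
* §3 THE ROWS (every place with `e > 0`, `m ≥ 0`; every datum with weights `≥ 0`): **`κ = 1`: `3·T ≤ T_print`** (ratio `≤ 1/3`: the word REDUCES-STRONGLY is a
  theorem at every datum with `T_print > 0`, VANISHES where part 1's saturation law fires); **affine `½`: `T ≤ T_print` in label units, i.e. `≤ ½·T_print` in
  mass units** (REDUCES-STRONGLY a theorem); **`κ = 3/2`: `3·T ≤ 2·T_print`** (`≤ 2/3`: REDUCES a theorem; the table's STRONGLY `0.0185 | 0.0096` is the
  engines' datum); **shift `a`: `(L+1+2a)·T_print ≤ (L+1)·T`** (`≥ 1 + 2a/(l⋆+1)`, `≥ 1.01` iff `l⋆ ≤ 200a − 1`); **affine `c ≥ 1`: `c·T_print ≤ T`**;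
  **`κ = 5/2`: `5·T_print ≤ 3·T`**; **`κ = 3`: `7·T_print ≤ 3·T`** (INCREASES a theorem wherever `T_print > 0`). Worked place FREY `p = 7`, `l = 107` (part 3b:
  `40601 · 0 · 0 · 44404 · 99560`): `3·0 ≤ 40601`, `56·40601 = 2273656 ≤ 54·44404 = 2397816`, `2·40601 ≤ 99560` — instances, non-vacuous.
HONEST FRAMING: integer/real arithmetic about OUR typed cell with a free pilot law (a PARAMETER — REQB-SPEC FRAMING; CONSISTENCY with IUT I–III is
abc-iut-reqb-rf-1's column); tier L0 only (`T = M − K_L0`); the table's pooled/median numbers are the engines' (A ≡ B) — the theorems bound them, they do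
not recompute them; nothing here asserts that abc is proved or refuted, or that [IUTchIII] Cor. 3.12 / [IUTchIV] Thm. 1.10 holds or fails at any datum, or
takes a side on any author; typed ≠ proved; computed ≠ proved. [claim: Mochizuki2012, status: disputed] for every IUT locution.
[cite: Mochizuki2012, IUTchIII Cor. 3.12 p. 173–174, Rmk. 3.9.3 p. 119–120; IUTchIV Prop. 1.4 p. 13, Thm. 1.10 Step (v) p. 27–29]
-/

noncomputable section

open Finset

namespace Summit.ABC.IUTFork.Repair.RH.ReqsideWeightLaws

/-! ## §1. Ratio transfer through the unlicensed-set inclusion -/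

open Classical in
/-- **RATIO TRANSFER.** At a place (`e > 0`, `m ≥ 0`, denominators `> 0`, `b ≥ 0`): if on labels `1 ≤ j ≤ L` the law `f/den` is below `g/den′`
(`f(j)·den′ ≤ g(j)·den`), `g`'s demands are `≥ 0` (`den′ ≤ g(j)`), and termwise `a·(f(j) − den) ≤ b·(g(j) − den′)`, then `a·T_f(w) ≤ b·T_g(w)` in label
units — every label unlicensed under `f` is unlicensed under `g` (part 3a `cell_of_mul_le_of_cell`) and carries at most `b/a` of its demand. [folklore] -/
theorem offDemand_ratio_le {f g : ℕ → ℤ} {den den' e m δ rin rout a b : ℤ} (hden : 0 < den) (hden' : 0 < den') (he : 0 < e) (hm : 0 ≤ m)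
    (hb : 0 ≤ b) {L : ℕ} (hg' : ∀ j, 1 ≤ j → j ≤ L → den' ≤ g j) (hfg : ∀ j, 1 ≤ j → j ≤ L → f j * den' ≤ g j * den)
    (hab : ∀ j, 1 ≤ j → j ≤ L → a * (f j - den) ≤ b * (g j - den')) :
    a * offDemand f den e m δ rin rout L ≤ b * offDemand g den' e m δ rin rout L := by
  unfold offDemand
  rw [Finset.mul_sum, Finset.mul_sum]
  refine Finset.sum_le_sum fun i hi => ?_
  rw [Finset.mem_range] at hi
  have hiL : i + 1 ≤ L := by omega
  have h3 := hg' (i + 1) (Nat.succ_pos i) hiL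
  have h2 := hfg (i + 1) (Nat.succ_pos i) hiL
  have h4 := hab (i + 1) (Nat.succ_pos i) hiL
  by_cases hg : Cell g den' e m δ rin rout (i + 1)
  · rw [if_pos hg, if_pos (cell_of_mul_le_of_cell hden hden' he hm h2 hg), mul_zero, mul_zero]
  · rw [if_neg hg]
    split_ifs
    · rw [mul_zero]; exact mul_nonneg hb (by linarith)
    · exact h4

section Datum

variable {ι : Type*} {s : Finset ι} {e m δ rin rout : ι → ℤ} {q : ι → ℝ}

/-- **RATIO TRANSFER, POOLED** (nats): under the hypotheses of `offDemand_ratio_le` at every place of `s` and weights `q_w ≥ 0`,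
`a·den·T_f(datum) ≤ b·den′·T_g(datum)` (`datumOff` divides by the law's own denominator). Hence the same ratio bounds every bed-level pooled sum, and — a
datum-wise dominated column has dominated order statistics — every median. [folklore] -/
theorem datumOff_ratio_le {f g : ℕ → ℤ} {den den' a b : ℤ} (hden : 0 < den) (hden' : 0 < den') (he : ∀ w ∈ s, 0 < e w) (hm : ∀ w ∈ s, 0 ≤ m w)
    (hq : ∀ w ∈ s, 0 ≤ q w) (hb : 0 ≤ b) {L : ℕ} (hg' : ∀ j, 1 ≤ j → j ≤ L → den' ≤ g j)
    (hfg : ∀ j, 1 ≤ j → j ≤ L → f j * den' ≤ g j * den) (hab : ∀ j, 1 ≤ j → j ≤ L → a * (f j - den) ≤ b * (g j - den')) :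
    (a : ℝ) * den * datumOff f den s e m δ rin rout q L ≤ (b : ℝ) * den' * datumOff g den' s e m δ rin rout q L := by
  unfold datumOff
  rw [Finset.mul_sum, Finset.mul_sum]
  refine Finset.sum_le_sum fun w hw => ?_
  have hd : (den : ℝ) ≠ 0 := by exact_mod_cast hden.ne'
  have hd' : (den' : ℝ) ≠ 0 := by exact_mod_cast hden'.ne'
  have h := offDemand_ratio_le (e := e w) (m := m w) (δ := δ w) (rin := rin w) (rout := rout w)
    hden hden' (he w hw) (hm w hw) hb hg' hfg hab
  have h' : (a : ℝ) * (offDemand f den (e w) (m w) (δ w) (rin w) (rout w) L : ℝ) ≤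
      (b : ℝ) * (offDemand g den' (e w) (m w) (δ w) (rin w) (rout w) L : ℝ) := by exact_mod_cast h
  have e1 : (a : ℝ) * den * (((offDemand f den (e w) (m w) (δ w) (rin w) (rout w) L : ℤ) : ℝ) / den * q w) =
      (a : ℝ) * (offDemand f den (e w) (m w) (δ w) (rin w) (rout w) L : ℝ) * q w := by
    field_simp
  have e2 : (b : ℝ) * den' * (((offDemand g den' (e w) (m w) (δ w) (rin w) (rout w) L : ℤ) : ℝ) / den' * q w) =
      (b : ℝ) * (offDemand g den' (e w) (m w) (δ w) (rin w) (rout w) L : ℝ) * q w := by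
    field_simp
  rw [e1, e2]
  exact mul_le_mul_of_nonneg_right h' (hq w hw)

end Datum

/-! ## §2. The law inequalities (label arithmetic) -/

/-- `κ = 1` vs print: `3(j − 1) ≤ j² − 1` for every natural `j` (`(j−1)(j−2) ≥ 0` on `ℕ`). [folklore] -/
theorem three_mul_id_sub_one_le (j : ℕ) : 3 * ((j : ℤ) - 1) ≤ 1 * ((j : ℤ) ^ 2 - 1) := by
  rcases Nat.lt_or_ge j 2 with h | h
  · interval_cases j <;> norm_num
  · have h2 : (2 : ℤ) ≤ j := by exact_mod_cast h
    nlinarith [mul_nonneg (by linarith : (0 : ℤ) ≤ (j : ℤ) - 1) (by linarith : (0 : ℤ) ≤ (j : ℤ) - 2)]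

/-- **`κ = 3/2` vs print: `3(⌈j^{3/2}⌉ − 1) ≤ 2(j² − 1)`** for `j ≥ 1` — via the integer certificate `⌈j^{3/2}⌉ ≤ s := ⌊(2j²+1)/3⌋` (`j³ ≤ s²` since
`3s ≥ 2j² − 1` and `(2j² − 1)² ≥ 9j³` for `j ≥ 3`; `j = 1, 2` directly: `⌈1⌉ = 1`, `⌈2^{3/2}⌉ ≤ 3` as `8 ≤ 9`). No root is evaluated. [folklore] -/
theorem three_mul_lawPow_three_sub_one_le {j : ℕ} (hj : 1 ≤ j) : 3 * (lawPow 3 j - 1) ≤ 2 * ((j : ℤ) ^ 2 - 1) := by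
  rcases Nat.lt_or_ge j 3 with h | h
  · interval_cases j
    · rw [lawPow_at_one]; norm_num
    · have h2 : lawPow 3 2 ≤ (3 : ℕ) := lawPow_le_of_pow_le_sq (by norm_num)
      push_cast at h2 ⊢
      linarith
  · set s : ℕ := (2 * j ^ 2 + 1) / 3 with hs
    have hdm := Nat.div_add_mod (2 * j ^ 2 + 1) 3
    have hml : (2 * j ^ 2 + 1) % 3 < 3 := Nat.mod_lt _ (by norm_num)
    have hs1 : 2 * j ^ 2 ≤ 3 * s + 1 := by omega
    have hs2 : 3 * s ≤ 2 * j ^ 2 + 1 := by omega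
    have hj3 : (3 : ℤ) ≤ j := by exact_mod_cast h
    have hs1' : 2 * (j : ℤ) ^ 2 ≤ 3 * (s : ℤ) + 1 := by exact_mod_cast hs1
    have hs2' : 3 * (s : ℤ) ≤ 2 * (j : ℤ) ^ 2 + 1 := by exact_mod_cast hs2
    have hcube : (j : ℤ) ^ 3 ≤ (s : ℤ) ^ 2 := by
      have hA : (0 : ℤ) ≤ 2 * (j : ℤ) ^ 2 - 1 := by nlinarith
      have hB : (2 * (j : ℤ) ^ 2 - 1) ^ 2 ≤ (3 * (s : ℤ)) ^ 2 := by nlinarith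
      have hC : 9 * (j : ℤ) ^ 3 ≤ (2 * (j : ℤ) ^ 2 - 1) ^ 2 := by
        nlinarith [mul_nonneg (mul_nonneg (by linarith : (0 : ℤ) ≤ (j : ℤ) - 3) (by linarith : (0 : ℤ) ≤ 4 * (j : ℤ) + 3))
          (sq_nonneg (j : ℤ)), sq_nonneg (j : ℤ)]
      nlinarith
    have hcube' : j ^ 3 ≤ s ^ 2 := by exact_mod_cast hcube
    have hle : lawPow 3 j ≤ (s : ℕ) := lawPow_le_of_pow_le_sq hcube'
    linarith

/-- Shift `a` vs print on `{1..L}`: `(L+1+2a)(j² − 1) ≤ (L+1)((j+a)² − (1+a)² + 1 − 1)` (difference `2a(j−1)(L−j) ≥ 0`). [folklore] -/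
theorem shift_ratio_law (a : ℕ) {j L : ℕ} (hj : 1 ≤ j) (hjL : j ≤ L) :
    ((L : ℤ) + 1 + 2 * a) * ((j : ℤ) ^ 2 - 1) ≤ ((L : ℤ) + 1) * (lawShift a j - 1) := by
  unfold lawShift
  have hj' : (1 : ℤ) ≤ j := by exact_mod_cast hj
  have hjL' : (j : ℤ) ≤ L := by exact_mod_cast hjL
  have ha : (0 : ℤ) ≤ a := Nat.cast_nonneg a
  nlinarith [mul_nonneg (mul_nonneg ha (by linarith : (0 : ℤ) ≤ (j : ℤ) - 1)) (by linarith : (0 : ℤ) ≤ (L : ℤ) - j)]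

/-- Affine `c ≥ 1` vs print: `c(j² − 1) ≤ c·j² − 1`. [folklore] -/
theorem affine_ratio_law {c : ℕ} (hc : 1 ≤ c) (j : ℕ) : (c : ℤ) * ((j : ℤ) ^ 2 - 1) ≤ 1 * (lawAffine c j - 1) := by
  unfold lawAffine
  have hc' : (1 : ℤ) ≤ c := by exact_mod_cast hc
  nlinarith

/-- **`κ = 5/2` vs print: `5(j² − 1) ≤ 3(⌈j^{5/2}⌉ − 1)`** for `j ≥ 1` — certificates `⌈j^{5/2}⌉ ≥ 2j²` for `j ≥ 4` (`(2j²)² = 4j⁴ ≤ j⁵`), `≥ 6` at `j = 2`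
(`5² < 2⁵`), `≥ 16` at `j = 3` (`15² < 3⁵`). [folklore] -/
theorem five_mul_sq_sub_one_le_lawPow_five {j : ℕ} (hj : 1 ≤ j) : 5 * ((j : ℤ) ^ 2 - 1) ≤ 3 * (lawPow 5 j - 1) := by
  rcases Nat.lt_or_ge j 4 with h | h
  · interval_cases j
    · rw [lawPow_at_one]; norm_num
    · have h2 : (5 : ℤ) + 1 ≤ lawPow 5 2 := by exact_mod_cast succ_le_lawPow_of_sq_lt (a := 5) (j := 2) (s := 5) (by norm_num)
      push_cast; linarith
    · have h3 : (15 : ℤ) + 1 ≤ lawPow 5 3 := by exact_mod_cast succ_le_lawPow_of_sq_lt (a := 5) (j := 3) (s := 15) (by norm_num)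
      push_cast; linarith
  · have hsq : (2 * j ^ 2) ^ 2 ≤ j ^ 5 := by
      calc (2 * j ^ 2) ^ 2 = 4 * j ^ 4 := by ring
        _ ≤ j * j ^ 4 := Nat.mul_le_mul_right _ h
        _ = j ^ 5 := by ring
    have hge : ((2 * j ^ 2 : ℕ) : ℤ) ≤ lawPow 5 j := by
      unfold lawPow
      rw [← ceilSqrt_sq (2 * j ^ 2)]
      exact_mod_cast ceilSqrt_mono hsq
    push_cast at hge
    nlinarith

/-- `κ = 3` vs print: `7(j² − 1) ≤ 3(j³ − 1)` for every natural `j` (`(j−1)(j−2)(3j+2) ≥ 0` on `ℕ`). [folklore] -/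
theorem seven_mul_sq_sub_one_le_cube (j : ℕ) : 7 * ((j : ℤ) ^ 2 - 1) ≤ 3 * ((j : ℤ) ^ 3 - 1) := by
  rcases Nat.lt_or_ge j 2 with h | h
  · interval_cases j <;> norm_num
  · have h2 : (2 : ℤ) ≤ j := by exact_mod_cast h
    nlinarith [mul_nonneg (mul_nonneg (by linarith : (0 : ℤ) ≤ (j : ℤ) - 1) (by linarith : (0 : ℤ) ≤ (j : ℤ) - 2))
      (by linarith : (0 : ℤ) ≤ 3 * (j : ℤ) + 2)]

/-! ## §3. The rows: ratio bounds at every place (hence every datum and bed) -/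

section Rows

variable {e m : ℤ} (he : 0 < e) (hm : 0 ≤ m) (δ rin rout : ℤ) (L : ℕ)
include he hm

/-- **ROW S-k1-kappa1: `3·T_{κ=1}(w) ≤ T_print(w)`** — `T_mod/T ≤ 1/3` at every place, datum and bed: REDUCES-STRONGLY (`≤ 0.5`) is a THEOREM wherever
`T_print > 0` (table: `0.0002 | 0.0000`, i.e. VANISHES/REDUCES-STRONGLY). [folklore] -/
theorem row_kappaOne_ratio :
    3 * offDemand (fun j => (j : ℤ)) 1 e m δ rin rout L ≤ offDemand (fun j => (j : ℤ) ^ 2) 1 e m δ rin rout L := by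
  have h := offDemand_ratio_le (f := fun j => (j : ℤ)) (g := fun j => (j : ℤ) ^ 2) (δ := δ) (rin := rin) (rout := rout) (a := 3) (b := 1)
    one_pos one_pos he hm zero_le_one (L := L)
    (fun j hj _ => by have h1 : (1 : ℤ) ≤ j := (by exact_mod_cast hj); nlinarith)
    (fun j hj _ => by have h1 : (1 : ℤ) ≤ j := (by exact_mod_cast hj); nlinarith)
    (fun j _ _ => three_mul_id_sub_one_le j)
  linarith

/-- **ROW S-k1-affine1/2: `T_{affine ½}(w) ≤ T_print(w)` in label units, i.e. `T_{affine ½}/2 ≤ ½·T_print` in mass units** — REDUCES-STRONGLY is a THEOREM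
wherever `T_print > 0` (table: `0.0951 | 0.0413`). Sharpens part 3a's `offDemand_affineHalf_le_sq`. [folklore] -/
theorem row_affineHalf_ratio :
    offDemand (lawAffine 1) 2 e m δ rin rout L ≤ offDemand (fun j => (j : ℤ) ^ 2) 1 e m δ rin rout L := by
  have h := offDemand_ratio_le (f := lawAffine 1) (g := fun j => (j : ℤ) ^ 2) (den := 2) (den' := 1) (δ := δ) (rin := rin) (rout := rout)
    (a := 1) (b := 1) two_pos one_pos he hm zero_le_one (L := L)
    (fun j hj _ => by have h1 : (1 : ℤ) ≤ j := (by exact_mod_cast hj); nlinarith)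
    (fun j _ _ => by unfold lawAffine; push_cast; nlinarith [sq_nonneg (j : ℤ)])
    (fun j _ _ => by unfold lawAffine; push_cast; linarith)
  linarith

/-- **ROW S-k1-kappa3/2: `3·T_{κ=3/2}(w) ≤ 2·T_print(w)`** — `T_mod/T ≤ 2/3`: REDUCES (`≤ 0.9`) is a THEOREM wherever `T_print > 0`; the table's
REDUCES-STRONGLY (`0.0185 | 0.0096`) is the engines' datum beyond this bound. [folklore] -/
theorem row_kappaThreeHalves_ratio :
    3 * offDemand (lawPow 3) 1 e m δ rin rout L ≤ 2 * offDemand (fun j => (j : ℤ) ^ 2) 1 e m δ rin rout L :=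
  offDemand_ratio_le one_pos one_pos he hm (by norm_num)
    (fun j hj _ => by have h1 : (1 : ℤ) ≤ j := (by exact_mod_cast hj); nlinarith)
    (fun j hj _ => by simpa using (lawPow_three_bracket hj).2)
    (fun j hj _ => three_mul_lawPow_three_sub_one_le hj)

/-- **ROWS S-k1-shift1, S-k1-shift2: `(L + 1 + 2a)·T_print(w) ≤ (L + 1)·T_{shift a}(w)`** — `T_mod/T ≥ 1 + 2a/(l⋆ + 1)` wherever `T_print > 0`
(`≥ 1.037 / 1.074` at `l⋆ = 53`; INCREASES `≥ 1.01` a theorem for `l⋆ ≤ 200a − 1`; table `1.2250 | 1.1988`, `1.4575 | 1.3939`). [folklore] -/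
theorem row_shift_ratio (a : ℕ) :
    ((L : ℤ) + 1 + 2 * a) * offDemand (fun j => (j : ℤ) ^ 2) 1 e m δ rin rout L ≤ ((L : ℤ) + 1) * offDemand (lawShift a) 1 e m δ rin rout L :=
  offDemand_ratio_le one_pos one_pos he hm (by positivity)
    (fun j hj _ => by have h1 := sq_le_lawShift a hj; have h2 : (1 : ℤ) ≤ j := (by exact_mod_cast hj); nlinarith)
    (fun j hj _ => by simpa using sq_le_lawShift a hj)
    (fun j hj hjL => shift_ratio_law a hj hjL)

/-- **ROW S-k1-affine2 (and every `c ≥ 1`): `c·T_print(w) ≤ T_{affine c}(w)`** — `T_mod/T ≥ c` (table at `c = 2`: `3.4554 | 3.0693`). [folklore] -/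
theorem row_affine_ratio {c : ℕ} (hc : 1 ≤ c) :
    (c : ℤ) * offDemand (fun j => (j : ℤ) ^ 2) 1 e m δ rin rout L ≤ offDemand (lawAffine c) 1 e m δ rin rout L := by
  have h := offDemand_ratio_le (f := fun j => (j : ℤ) ^ 2) (g := lawAffine c) (δ := δ) (rin := rin) (rout := rout) (a := (c : ℤ)) (b := 1)
    one_pos one_pos he hm zero_le_one (L := L)
    (fun j hj _ => by have h1 := sq_le_lawAffine hc j; have h2 : (1 : ℤ) ≤ j := (by exact_mod_cast hj); nlinarith)
    (fun j _ _ => by simpa using sq_le_lawAffine hc j)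
    (fun j _ _ => affine_ratio_law hc j)
  linarith

/-- **ROW S-k1-kappa5/2: `5·T_print(w) ≤ 3·T_{κ=5/2}(w)`** — `T_mod/T ≥ 5/3` wherever `T_print > 0`: INCREASES a theorem (table `16.9066 | 32.1817`). [folklore] -/
theorem row_kappaFiveHalves_ratio :
    5 * offDemand (fun j => (j : ℤ) ^ 2) 1 e m δ rin rout L ≤ 3 * offDemand (lawPow 5) 1 e m δ rin rout L :=
  offDemand_ratio_le one_pos one_pos he hm (by norm_num)
    (fun j hj _ => one_le_lawPow 5 hj)
    (fun j hj _ => by simpa using (lawPow_five_bracket hj).1)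
    (fun j hj _ => five_mul_sq_sub_one_le_lawPow_five hj)

/-- **`κ = 3` (`lawPow 6 = j³`): `7·T_print(w) ≤ 3·T_{κ=3}(w)`** — `T_mod/T ≥ 7/3` wherever `T_print > 0`. [folklore] -/
theorem row_kappaThree_ratio :
    7 * offDemand (fun j => (j : ℤ) ^ 2) 1 e m δ rin rout L ≤ 3 * offDemand (lawPow 6) 1 e m δ rin rout L := by
  rw [(offDemand_lawPow_two_four_six e m δ rin rout L).2.2]
  exact offDemand_ratio_le one_pos one_pos he hm (by norm_num)
    (fun j hj _ => by
      have h2 : (1 : ℤ) ≤ j := (by exact_mod_cast hj)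
      have hj2 : (1 : ℤ) ≤ (j : ℤ) ^ 2 := by nlinarith
      have h3 : (1 : ℤ) ≤ (j : ℤ) ^ 3 := by nlinarith [mul_nonneg (sub_nonneg.2 h2) (sub_nonneg.2 hj2)]
      linarith)
    (fun j hj _ => by
      have h2 : (1 : ℤ) ≤ j := (by exact_mod_cast hj)
      have h3 : (j : ℤ) ^ 2 ≤ (j : ℤ) ^ 3 := by nlinarith [sq_nonneg (j : ℤ)]
      linarith)
    (fun j _ _ => seven_mul_sq_sub_one_le_cube j)

end Rows

/-- THE WORKED PLACE INSTANCES (FREY `p = 7`, `l = 107`; part 3b `worked_offDemand`: `T_print = 40601`, `T_{κ=1} = 0`, `T_shift1 = 44404`, `T_affine2 = 99560`):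
`3·0 ≤ 40601`; `(53+1+2)·40601 = 2273656 ≤ 54·44404 = 2397816`; `2·40601 = 81202 ≤ 99560` — the row bounds are met with room, non-vacuously. [folklore] -/
theorem worked_ratios :
    3 * offDemand (fun j => (j : ℤ)) 1 1605 210 1604 268 (-4472) 53 ≤ offDemand (fun j => (j : ℤ) ^ 2) 1 1605 210 1604 268 (-4472) 53 ∧
      ((53 : ℤ) + 1 + 2 * (1 : ℕ)) * offDemand (fun j => (j : ℤ) ^ 2) 1 1605 210 1604 268 (-4472) 53 ≤
          ((53 : ℤ) + 1) * offDemand (lawShift 1) 1 1605 210 1604 268 (-4472) 53 ∧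
        (2 : ℤ) * offDemand (fun j => (j : ℤ) ^ 2) 1 1605 210 1604 268 (-4472) 53 ≤ offDemand (lawAffine 2) 1 1605 210 1604 268 (-4472) 53 := by
  obtain ⟨hP, h1, -, hS, hA, -, -⟩ := worked_offDemand
  refine ⟨by rw [hP, h1]; norm_num, by rw [hP, hS]; norm_num, by rw [hP, hA]; norm_num⟩

end Summit.ABC.IUTFork.Repair.RH.ReqsideWeightLaws

end
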